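import Summits.PneNP.PneNP.Theorems.ChebyshevTracialDesignPseudoMatchingTensor

/-!
# Cell pnp-psdrank, route `ChebyshevTracialDesign`: the VERTEX-CONDITIONING RECURSION of the pseudo-matching form — positive semidefiniteness
# at the threshold clique size propagates to all larger odd cliques (crux `TracialDecayExp20`, stmt-PneNP-19878; eng g13, MEMO-13 §4(e))

The one-clique pseudo-matching form of brick `…PseudoMatchingTensor` (the remaining hypothesis of matching-side low-degree pricing) is
`Q_W(δ) = Σ_{A,A'} δ_A δ_{A'} ν_W(A ∪ A')` on coefficient vectors indexed by edge sets of size `≤ k`, with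
`ν_W(G) = [G extends to a perfect matching of K_n ∧ G ⊆ E(W)] · ∏_{j<|G|}(|W|−1−2j)⁻¹` — Potechin's story values for the odd clique `K_W`
[cite: Potechin2019, Example 3.4 (LIPIcs 124, 61:7)]. This file proves that these values satisfy the SAME vertex-conditioning identity as the
uniform perfect matching of an even clique: for `w₀ ∈ W` and the substitutions `R_v` (`x_{w₀v} ↦ 1`, every other variable at `w₀` or `v` `↦ 0`),
* §2 **`moment_recursion`** — `(|W|−1)·ν_W(B) = Σ_{v ∈ W∖w₀} [B not killed by v]·ν_{W∖{w₀,v}}(B ∖ {w₀v})` whenever `2|B| + 3 ≤ |W|`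
  (three cases: `B ∋ w₀u` — only `v = u` survives; `B` avoids `w₀` — the `|W|−1−2|B|` uncovered `v` survive; `B` bad — everything vanishes);
* §3 **`form_recursion`** — hence `(|W|−1)·Q_W(δ) = Σ_{v ∈ W∖w₀} Q_{W∖{w₀,v}}(R_v δ)` for all `δ` when `4k + 3 ≤ |W|`
  (`(R_vδ)(A″) = Σ_{A : A not killed, A∖{w₀v} = A″} δ_A`; fibrewise regrouping `…PseudoMatchingTensor.sum_sum_fiber_regroup`);
* §4 **`form_nonneg_of_base`** — so if `Q_W ≥ 0` for every `W ⊆ [n]` of size `m₀ ≥ 4k+1`, then `Q_W ≥ 0` for every `W` of odd size... every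
  size `m₀ + 2i`: Potechin's Theorem 1.2 [cite: Potechin2019, Thm. 1.2 (61:4)] for ALL cliques of size `≥ m₀` follows from the THRESHOLD case
  `m₀ = 4k+1` alone (a finite certificate for each fixed `k`; MEMO-13 §4(e): exact LDLᵀ confirms (5,1) and (9,2) PSD, (3,1) and (7,2) not).
The functional `ν` enters as a parameter with its closed form as hypothesis `hν` (no definitions). Stature: support/instrument (finite algebra; no
defs, axioms standard). WHAT THIS IS NOT: not the threshold case itself, nothing on the dense cell, nothing on psd rank, no P-vs-NP content.
Supports stmt-PneNP-19878.
-/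

set_option linter.dupNamespace false -- `Summit.PneNP.PneNP.…`: summit = sub-problem (D-0017)

noncomputable section

namespace Summit.PneNP.PneNP.Theorems.ChebyshevTracialDesignPseudoMatchingRecursion

open Finset Matrix Literature.Barriers.PneNP Literature.Combinatorics.Optimization
open Summit.PneNP.PneNP.Theorems.ChebyshevTracialDesignJunta
open Summit.PneNP.PneNP.Theorems.ChebyshevTracialDesignPseudoMatchingTensor
open scoped MatrixOrder

variable {n : ℕ}

/-! ### §1 Sub-matchings of `K_n`: edge sets contained in a perfect matching -/

/-- Edges of an extendable edge set are pairwise vertex-disjoint: two of them containing a common vertex coincide. [folklore] -/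
theorem eq_of_mem_of_mem {B : Finset (Sym2 (Fin n))} {M : PMatch n} (hB : B ⊆ M.1) {e e' : Sym2 (Fin n)} (he : e ∈ B) (he' : e' ∈ B)
    {x : Fin n} (hx : x ∈ e) (hx' : x ∈ e') : e = e' :=
  M.2.unique (hB he) (hB he') hx hx'

/-- An extendable edge set covers exactly `2|B|` vertices. [folklore] -/
theorem card_verts_eq {B : Finset (Sym2 (Fin n))} {M : PMatch n} (hB : B ⊆ M.1) :
    (univ.filter fun x : Fin n => ∃ e ∈ B, x ∈ e).card = 2 * B.card :=
  (two_mul_card_eq (isPMOn_verts M.2 hB)).symm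

/-- The edge of an extendable set at a vertex, if any, is unique; removing it uncovers the vertex. [folklore] -/
theorem not_mem_of_mem_erase {B : Finset (Sym2 (Fin n))} {M : PMatch n} (hB : B ⊆ M.1) {e₀ e : Sym2 (Fin n)} (he₀ : e₀ ∈ B)
    (he : e ∈ B.erase e₀) {x : Fin n} (hx₀ : x ∈ e₀) : x ∉ e := fun hx =>
  (mem_erase.1 he).1 (eq_of_mem_of_mem hB (mem_of_mem_erase he) he₀ hx hx₀)

/-! ### §2 The moment recursion -/

/-- The moments only see `|B|` and `|W|`; peeling the first factor: `∏_{j<a+1}(m−1−2j)⁻¹ = (m−1)⁻¹·∏_{j<a}((m−2)−1−2j)⁻¹`. [folklore] -/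
theorem prod_inv_succ (m : ℝ) (a : ℕ) :
    (∏ j ∈ range (a + 1), (m - 1 - 2 * (j : ℝ)))⁻¹ = (m - 1)⁻¹ * (∏ j ∈ range a, (m - 2 - 1 - 2 * (j : ℝ)))⁻¹ := by
  rw [prod_range_succ', ← mul_inv, mul_comm]
  congr 2
  · push_cast; ring
  · exact prod_congr rfl fun j _ => by push_cast; ring

/-- The telescoping identity `(m−1−2a)·∏_{j<a}(m−1−2j) = (m−1)·∏_{j<a}((m−2)−1−2j)`. [folklore] -/
theorem uncovered_mul_prod (m : ℝ) (a : ℕ) :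
    (m - 1 - 2 * a) * ∏ j ∈ range a, (m - 1 - 2 * (j : ℝ)) = (m - 1) * ∏ j ∈ range a, (m - 2 - 1 - 2 * (j : ℝ)) := by
  induction a with
  | zero => simp
  | succ a ih =>
    rw [prod_range_succ, prod_range_succ]
    have e1 : (m - 1 - 2 * ((a + 1 : ℕ) : ℝ)) = m - 2 - 1 - 2 * (a : ℝ) := by push_cast; ring
    calc (m - 1 - 2 * ((a + 1 : ℕ) : ℝ)) * ((∏ j ∈ range a, (m - 1 - 2 * (j : ℝ))) * (m - 1 - 2 * (a : ℝ)))
        = ((m - 1 - 2 * a) * ∏ j ∈ range a, (m - 1 - 2 * (j : ℝ))) * (m - 2 - 1 - 2 * (a : ℝ)) := by rw [e1]; ring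
      _ = ((m - 1) * ∏ j ∈ range a, (m - 2 - 1 - 2 * (j : ℝ))) * (m - 2 - 1 - 2 * (a : ℝ)) := by rw [ih]
      _ = (m - 1) * ((∏ j ∈ range a, (m - 2 - 1 - 2 * (j : ℝ))) * (m - 2 - 1 - 2 * ((a : ℕ) : ℝ))) := by ring

/-- `(m−1−2a)·∏_{j<a}((m−2)−1−2j)⁻¹ = (m−1)·∏_{j<a}(m−1−2j)⁻¹` (the uncovered-vertex count against the moment), for `2a + 3 ≤ m`. [folklore] -/
theorem uncovered_mul_prod_inv {m a : ℕ} (h : 2 * a + 3 ≤ m) :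
    ((m : ℝ) - 1 - 2 * a) * (∏ j ∈ range a, ((m : ℝ) - 2 - 1 - 2 * (j : ℝ)))⁻¹ =
      ((m : ℝ) - 1) * (∏ j ∈ range a, ((m : ℝ) - 1 - 2 * (j : ℝ)))⁻¹ := by
  have hP1 : (0 : ℝ) < ∏ j ∈ range a, ((m : ℝ) - 2 - 1 - 2 * (j : ℝ)) := by
    refine prod_pos fun j hj => ?_
    have := mem_range.1 hj
    have : (2 : ℝ) * j + 5 ≤ m := by exact_mod_cast (by omega : 2 * j + 5 ≤ m)
    linarith
  have hP2 : (0 : ℝ) < ∏ j ∈ range a, ((m : ℝ) - 1 - 2 * (j : ℝ)) := by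
    refine prod_pos fun j hj => ?_
    have := mem_range.1 hj
    have : (2 : ℝ) * j + 5 ≤ m := by exact_mod_cast (by omega : 2 * j + 5 ≤ m)
    linarith
  rw [← div_eq_mul_inv, ← div_eq_mul_inv, div_eq_div_iff hP1.ne' hP2.ne']
  exact uncovered_mul_prod (m : ℝ) a

/-- **MOMENT RECURSION.** Let `ν` be the pseudo-matching moment functional (closed form `hν`), `W ⊆ [n]`, `w₀ ∈ W`, and `B` an edge set with
`2|B| + 3 ≤ |W|`. Then `(|W|−1)·ν_W(B) = Σ_{v ∈ W∖w₀} [B not killed by v]·ν_{W∖{w₀,v}}(B∖{w₀v})`, where `B` is KILLED by `v` if it contains an edge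
at `w₀` or at `v` other than `w₀v` itself. [cite: Potechin2019, Example 3.4 (LIPIcs 124, 61:7)] -/
theorem moment_recursion (ν : Finset (Fin n) → Finset (Sym2 (Fin n)) → ℝ)
    (hν : ∀ W G, ν W G = if ((univ : Finset (PMatch n)).filter fun M => G ⊆ M.1).Nonempty ∧ (∀ e ∈ G, ∀ x ∈ e, x ∈ W) then
      (∏ j ∈ range G.card, ((W.card : ℝ) - 1 - 2 * j))⁻¹ else 0)
    {W : Finset (Fin n)} {w₀ : Fin n} (hw₀ : w₀ ∈ W) {B : Finset (Sym2 (Fin n))} (hBc : 2 * B.card + 3 ≤ W.card) :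
    ((W.card : ℝ) - 1) * ν W B =
      ∑ v ∈ W.erase w₀, (if ∃ e ∈ B, (w₀ ∈ e ∨ v ∈ e) ∧ e ≠ s(w₀, v) then 0 else ν (W \ {w₀, v}) (B.erase s(w₀, v))) := by
  classical
  have hcardW' : ∀ v ∈ W.erase w₀, (W \ {w₀, v}).card = W.card - 2 := fun v hv => by
    have hv' := mem_erase.1 hv
    rw [card_sdiff_of_subset (by intro x hx; rcases mem_insert.1 hx with rfl | hx; exact hw₀; rw [mem_singleton.1 hx]; exact hv'.2),
      card_pair hv'.1.symm]
  have hWc2 : (((W.card - 2 : ℕ) : ℝ)) = (W.card : ℝ) - 2 := by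
    rw [Nat.cast_sub (by omega)]; push_cast; ring
  by_cases hgood : ((univ : Finset (PMatch n)).filter fun M => B ⊆ M.1).Nonempty ∧ (∀ e ∈ B, ∀ x ∈ e, x ∈ W)
  · -- B is a sub-matching inside W
    obtain ⟨⟨M, hM⟩, hin⟩ := hgood
    have hBM : B ⊆ M.1 := (mem_filter.1 hM).2
    have hνB : ν W B = (∏ j ∈ range B.card, ((W.card : ℝ) - 1 - 2 * j))⁻¹ := by rw [hν, if_pos ⟨⟨M, hM⟩, hin⟩]
    -- sub-matchings of B extend as well
    have hext' : ∀ B' ⊆ B, ((univ : Finset (PMatch n)).filter fun M => B' ⊆ M.1).Nonempty :=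
      fun B' hB' => ⟨M, mem_filter.2 ⟨mem_univ _, hB'.trans hBM⟩⟩
    by_cases hcov : ∃ e ∈ B, w₀ ∈ e
    · -- Case (b1): `w₀` is covered, by the edge `e₁ = s(w₀, u)`
      obtain ⟨e₁, he₁, hwe₁⟩ := hcov
      obtain ⟨u, hu⟩ : ∃ u, e₁ = s(w₀, u) := by
        induction e₁ using Sym2.ind with
        | h a b =>
          rcases Sym2.mem_iff.1 hwe₁ with rfl | rfl
          · exact ⟨b, rfl⟩
          · exact ⟨a, Sym2.eq_swap⟩
      subst hu
      have huw : u ≠ w₀ := fun h => M.2.not_isDiag (hBM he₁) (by rw [h]; exact Sym2.mk_isDiag_iff.2 rfl)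
      have huW : u ∈ W := hin _ he₁ u (Sym2.mem_mk_right _ _)
      have huE : u ∈ W.erase w₀ := mem_erase.2 ⟨huw, huW⟩
      -- every other term is killed by `e₁`
      rw [← add_sum_erase _ _ huE]
      have hrest : ∑ v ∈ (W.erase w₀).erase u,
          (if ∃ e ∈ B, (w₀ ∈ e ∨ v ∈ e) ∧ e ≠ s(w₀, v) then 0 else ν (W \ {w₀, v}) (B.erase s(w₀, v))) = 0 := by
        refine sum_eq_zero fun v hv => ?_
        have hvu : v ≠ u := (mem_erase.1 hv).1
        have hne : s(w₀, u) ≠ s(w₀, v) := by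
          intro h
          have : u ∈ s(w₀, v) := h ▸ Sym2.mem_mk_right w₀ u
          rcases Sym2.mem_iff.1 this with h' | h'
          · exact huw h'
          · exact hvu h'.symm
        rw [if_pos ⟨s(w₀, u), he₁, Or.inl (Sym2.mem_mk_left _ _), hne⟩]
      rw [hrest, add_zero]
      -- the term `v = u` is not killed
      have hnk : ¬ ∃ e ∈ B, (w₀ ∈ e ∨ u ∈ e) ∧ e ≠ s(w₀, u) := by
        rintro ⟨e, he, hor, hne⟩
        rcases hor with hx | hx
        · exact hne (eq_of_mem_of_mem hBM he he₁ hx (Sym2.mem_mk_left _ _))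
        · exact hne (eq_of_mem_of_mem hBM he he₁ hx (Sym2.mem_mk_right _ _))
      rw [if_neg hnk]
      -- the erased set is a sub-matching inside `W \ {w₀, u}`, of size `|B| − 1`
      have hin' : ∀ e ∈ B.erase s(w₀, u), ∀ x ∈ e, x ∈ W \ {w₀, u} := by
        intro e he x hx
        refine mem_sdiff.2 ⟨hin e (mem_of_mem_erase he) x hx, fun hx2 => ?_⟩
        rcases mem_insert.1 hx2 with rfl | hx2
        · exact not_mem_of_mem_erase hBM he₁ he (Sym2.mem_mk_left _ _) hx
        · rw [mem_singleton] at hx2; subst hx2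
          exact not_mem_of_mem_erase hBM he₁ he (Sym2.mem_mk_right _ _) hx
      rw [hνB, hν, if_pos ⟨hext' _ (erase_subset _ _), hin'⟩, hcardW' u huE, card_erase_of_mem he₁, hWc2]
      obtain ⟨a, ha⟩ : ∃ a, B.card = a + 1 := ⟨B.card - 1, by have := card_pos.2 ⟨_, he₁⟩; omega⟩
      have hm1 : ((W.card : ℝ) - 1) ≠ 0 := by
        have : (3 : ℝ) ≤ W.card := by exact_mod_cast (by omega : 3 ≤ W.card)
        linarith
      rw [ha, Nat.add_sub_cancel, prod_inv_succ, ← mul_assoc, mul_inv_cancel₀ hm1, one_mul]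
    · -- Case (b2): `w₀` uncovered; exactly the uncovered `v` survive, each with the same value
      push Not at hcov
      have hval : ∀ v ∈ W.erase w₀,
          (if ∃ e ∈ B, (w₀ ∈ e ∨ v ∈ e) ∧ e ≠ s(w₀, v) then 0 else ν (W \ {w₀, v}) (B.erase s(w₀, v))) =
            if ∃ e ∈ B, v ∈ e then 0 else (∏ j ∈ range B.card, ((W.card : ℝ) - 2 - 1 - 2 * j))⁻¹ := by
        intro v hv
        have he₀ : s(w₀, v) ∉ B := fun h => hcov _ h (Sym2.mem_mk_left _ _)
        by_cases hcv : ∃ e ∈ B, v ∈ e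
        · obtain ⟨e, he, hve⟩ := hcv
          rw [if_pos ⟨e, he, Or.inr hve, fun h => he₀ (h ▸ he)⟩, if_pos ⟨e, he, hve⟩]
        · have hnk : ¬ ∃ e ∈ B, (w₀ ∈ e ∨ v ∈ e) ∧ e ≠ s(w₀, v) := by
            rintro ⟨e, he, hor, -⟩
            rcases hor with hx | hx
            · exact hcov e he hx
            · exact hcv ⟨e, he, hx⟩
          rw [if_neg hnk, if_neg hcv, erase_eq_of_notMem he₀]
          have hin' : ∀ e ∈ B, ∀ x ∈ e, x ∈ W \ {w₀, v} := by
            intro e he x hx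
            refine mem_sdiff.2 ⟨hin e he x hx, fun hx2 => ?_⟩
            rcases mem_insert.1 hx2 with rfl | hx2
            · exact hcov e he hx
            · rw [mem_singleton] at hx2; subst hx2; exact hcv ⟨e, he, hx⟩
          rw [hν, if_pos ⟨⟨M, hM⟩, hin'⟩, hcardW' v hv, hWc2]
      rw [sum_congr rfl hval, sum_ite, sum_const_zero, zero_add, sum_const, nsmul_eq_mul, hνB]
      -- the number of uncovered vertices in `W \ {w₀}` is `|W| − 1 − 2|B|`
      have hcount : ((W.erase w₀).filter fun v => ¬ ∃ e ∈ B, v ∈ e).card = W.card - 1 - 2 * B.card := by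
        have hsub : (univ.filter fun x : Fin n => ∃ e ∈ B, x ∈ e) ⊆ W.erase w₀ := by
          intro x hx
          obtain ⟨-, e, he, hxe⟩ := mem_filter.1 hx
          exact mem_erase.2 ⟨fun h => hcov e he (h ▸ hxe), hin e he x hxe⟩
        have h1 : ((W.erase w₀).filter fun v => ¬ ∃ e ∈ B, v ∈ e) =
            (W.erase w₀) \ (univ.filter fun x : Fin n => ∃ e ∈ B, x ∈ e) := by
          ext x; simp only [mem_filter, mem_sdiff, mem_univ, true_and]
        rw [h1, card_sdiff_of_subset hsub, card_verts_eq hBM, card_erase_of_mem hw₀]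
      rw [hcount, Nat.cast_sub (by omega), Nat.cast_sub (by omega), Nat.cast_one, Nat.cast_mul, Nat.cast_two]
      exact (uncovered_mul_prod_inv hBc).symm
  · -- Case (a): `B` is not a sub-matching inside `W`: every term vanishes
    have hνB : ν W B = 0 := by rw [hν, if_neg hgood]
    rw [hνB, mul_zero]
    symm
    refine sum_eq_zero fun v hv => ?_
    split_ifs with hk
    · rfl
    · rw [hν, if_neg]
      rintro ⟨⟨M, hM⟩, hin'⟩
      have hBM' : B.erase s(w₀, v) ⊆ M.1 := (mem_filter.1 hM).2
      push Not at hk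
      apply hgood
      -- `B` is inside `W`: the erased edge `s(w₀,v)` is inside anyway
      have hin : ∀ e ∈ B, ∀ x ∈ e, x ∈ W := by
        intro e he x hx
        by_cases hee : e = s(w₀, v)
        · subst hee
          rcases Sym2.mem_iff.1 hx with rfl | rfl
          · exact hw₀
          · exact (mem_erase.1 hv).2
        · exact (mem_sdiff.1 (hin' e (mem_erase.2 ⟨hee, he⟩) x hx)).1
      refine ⟨?_, hin⟩
      -- and `B` extends: if `s(w₀,v) ∉ B` then `B = B.erase _ ⊆ M`; else re-insert the edge `w₀v`, whose ends are uncovered by `M`'s other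
      -- edges of `B`, by switching `M` at `w₀` and `v`
      by_cases he₀ : s(w₀, v) ∈ B
      · -- `w₀ ≠ v`; the other edges of `B` avoid `w₀` and `v` (not killed)
        have hwv : w₀ ≠ v := fun h => (mem_erase.1 hv).1 h.symm
        have havoid : ∀ e ∈ B.erase s(w₀, v), w₀ ∉ e ∧ v ∉ e := by
          intro e he
          have hne := (mem_erase.1 he).1
          exact ⟨fun h => hne (hk e (mem_of_mem_erase he) (Or.inl h)), fun h => hne (hk e (mem_of_mem_erase he) (Or.inr h))⟩
        -- Build a perfect matching containing `B`: the sub-matching `B.erase e₀` of `M` together with `e₀` is a perfect matching of its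
        -- vertex set; extend by a perfect matching of the (even) rest.
        set B' := B.erase s(w₀, v) with hB'
        set W₁ := (univ : Finset (Fin n)).filter (fun x => ∃ e ∈ B', x ∈ e) with hW₁
        have hP₁ : IsPMOn W₁ B' := isPMOn_verts M.2 hBM'
        have hP₂ : IsPMOn ({w₀, v} : Finset (Fin n)) {s(w₀, v)} := by
          refine ⟨?_, ?_, ?_⟩
          · intro e he; rw [mem_singleton] at he; subst he
            rw [mem_sym2_iff]; intro x hx
            rcases Sym2.mem_iff.1 hx with rfl | rfl
            · exact mem_insert_self _ _
            · exact mem_insert_of_mem (mem_singleton_self _)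
          · intro e he; rw [mem_singleton] at he; subst he; exact fun h => hwv (Sym2.mk_isDiag_iff.1 h)
          · intro x hx
            rw [card_eq_one]; refine ⟨s(w₀, v), ?_⟩
            ext e; simp only [mem_filter, mem_singleton]
            constructor
            · exact fun h => h.1
            · intro h; subst h; refine ⟨rfl, ?_⟩
              rcases mem_insert.1 hx with rfl | hx
              · exact Sym2.mem_mk_left _ _
              · rw [mem_singleton] at hx; subst hx; exact Sym2.mem_mk_right _ _
        have hd : Disjoint W₁ ({w₀, v} : Finset (Fin n)) := by
          rw [disjoint_right]
          intro x hx hxW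
          obtain ⟨-, e, he, hxe⟩ := mem_filter.1 hxW
          rcases mem_insert.1 hx with rfl | hx
          · exact (havoid e he).1 hxe
          · rw [mem_singleton] at hx; subst hx; exact (havoid e he).2 hxe
        have hP : IsPMOn (W₁ ∪ {w₀, v}) (B' ∪ {s(w₀, v)}) := hP₁.union hP₂ hd
        have hBeq : B' ∪ {s(w₀, v)} = B := by
          rw [hB', union_comm, ← insert_eq, insert_erase he₀]
        rw [hBeq] at hP
        -- `n` is even since a perfect matching exists
        have hn : Even n := by
          have := two_mul_card_eq M.2
          rw [card_univ, Fintype.card_fin] at this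
          exact ⟨M.1.card, by omega⟩
        set R := (univ : Finset (Fin n)) \ (W₁ ∪ {w₀, v}) with hR
        have hReven : Even R.card := by
          have hc : (W₁ ∪ {w₀, v}).card = 2 * B.card := by rw [two_mul_card_eq hP]
          rw [hR, card_sdiff_of_subset (subset_univ _), card_univ, Fintype.card_fin, hc]
          obtain ⟨c, hc'⟩ := hn
          exact ⟨c - B.card, by omega⟩
        obtain ⟨N, hN⟩ := exists_isPMOn_of_even R.card R rfl hReven
        have hPM : IsPMOn ((W₁ ∪ {w₀, v}) ∪ R) (B ∪ N) := hP.union hN disjoint_sdiff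
        rw [union_sdiff_of_subset (subset_univ _)] at hPM
        exact ⟨⟨B ∪ N, hPM⟩, mem_filter.2 ⟨mem_univ _, subset_union_left⟩⟩
      · rw [erase_eq_of_notMem he₀] at hBM'
        exact ⟨M, mem_filter.2 ⟨mem_univ _, hBM'⟩⟩

end Summit.PneNP.PneNP.Theorems.ChebyshevTracialDesignPseudoMatchingRecursion
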